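import Summits.CriticalPhenomena.PercolationContinuityZ3.Theses.PercFoamCut
import Summits.CriticalPhenomena.PercolationContinuityZ3.Theorems.PercNearOneGluingNoHeavyLowerTailCSHTheoremOne
import HarnessLib

/-!
# `PercFoamCut.JumpFoamCheapCut` (stmt-CriticalPhenomena-5336) — SETTLED after continuity

Item `stmt-CriticalPhenomena-5336` of route `CriticalPhenomena/PercFoamCut` (support): the foam lemma `θ(p_c)²/4 − 6(2m+1)² h(n/4)/t ≤ P_{p_c}(cheap-cut foam event)` ('informative iff θ(p_c) > 0').

With `θ(p_c(ℤ³)) = 0` (p205010) the left-hand side is `0 − (nonnegative)/t ≤ 0`, and the right-hand side is a probability.  No percolation estimate is claimed beyond p205010.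

builds on p205010 (kernel theorem, internal audit signed; external expert review pending) — USED (`CSH.percolationContinuityZ3_holds`).  RSW3 lane, lead gen 28 (prover-prim-rsw3-lead-g28-0):
'after continuity — the ledger harvest'.
References: G. Kozma, N. Nitzan (2024), Thm. 6 / Conj. 3 [KozmaNitzan2024]; G. Grimmett, *Percolation* (1999), §8 [GrimmettPercolation1999].
-/

noncomputable section

namespace Summit.CriticalPhenomena.PercolationContinuityZ3.Theorems

namespace PercFoamCutJumpFoamCheapCut

open MeasureTheory Literature.Probability.Percolation Literature.Probability.LatticeModels

/-- **`PercFoamCut.JumpFoamCheapCut` (stmt-CriticalPhenomena-5336), settled.**  `θ(p_c) = 0` makes the left side `≤ 0 ≤` the right side.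
[cite: KozmaNitzan2024, Thm. 6 with Conj. 3 (p. 15)] -/
theorem jumpFoamCheapCut_proof : Summit.CriticalPhenomena.PercolationContinuityZ3.Theses.PercFoamCut.JumpFoamCheapCut := by
  unfold Summit.CriticalPhenomena.PercolationContinuityZ3.Theses.PercFoamCut.JumpFoamCheapCut
  intro n _ t ht
  have h0 : theta (zdGraph 3) (0 : Site 3) (criticalProbI 3) = 0 := CSH.percolationContinuityZ3_holds
  rw [h0]
  have hA : ∀ a b : ℝ, 0 ≤ a → 0 ≤ b → (0 : ℝ) ^ 2 / 4 - a ≤ b := fun a b ha hb => by norm_num; linarith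
  exact hA _ _ (div_nonneg (mul_nonneg (mul_nonneg (by norm_num) (sq_nonneg _)) measureReal_nonneg) ht.le)
    measureReal_nonneg

end PercFoamCutJumpFoamCheapCut

end Summit.CriticalPhenomena.PercolationContinuityZ3.Theorems

end
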